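import Literature.NumberTheory.PAdicHodge.EisensteinRootDatum
import Literature.NumberTheory.EllipticCurves.SupersingularFormalMulFrobenius
import Literature.NumberTheory.EllipticCurves.HasseInvariantTraceProofs
import Mathlib.AlgebraicGeometry.EllipticCurve.NormalForms
import HarnessLib

/-!
# Pure-power Eisenstein data `(X^e − p, p^{1/e})` and short Weierstrass models over `𝒪_D = ℤ_p[p^{1/e}]`: discriminant,
# reduction, Hasse coefficient at `5` and `7`, exact height by `𝔽_p`-descent (proofs only)

Topic `Literature/NumberTheory/PAdicHodge`; namespace `Literature.NumberTheory.PAdicHodge`. THEOREMS ONLY (no definition, no named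
fact, no instance, no `sorry`). Companion of `EisensteinRootDatum` (the datum `D = (f, ϖ)`, `𝒪_D = AdjoinRoot f`, `Coeff.toF`).

The (R1) road of the `p`-adic period programme (hDR on curves with potentially good SUPERSINGULAR reduction over a RAMIFIED base)
evaluates formal groups of Weierstrass equations with coefficients in `𝒪_D = ℤ_p[ϖ]`. This file supplies the ALGEBRA of the models
that occur for an elliptic curve over `ℚ` with additive potentially good reduction at `p ≥ 5` (Kodaira IV, III, II, IV*, III*, II*):
over `F ∋ ϖ` with `ϖ^e = p` the rescaled short model `y² = x³ − 27 c₄ ϖ^{−4k} x − 54 c₆ ϖ^{−6k}` (`12k = e·ord_p Δ`).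

* §1 `isEisensteinAt_X_pow_sub_C`, `EisensteinRoot.exists_poly_eq_X_pow_sub_C` — `X^e − p` is Eisenstein at `p`, so every
  `ϖ ∈ F` with `ϖ^e = p` carries an Eisenstein root datum `D` with `D.poly = X^e − p`, `D.root = ϖ`; then `ϱ^e = p` for the
  class `ϱ` of `X` in `𝒪_D` (`root_pow_eq_of_poly_eq`) and `ϖ^e = p` in `F`.
* §2 ring homomorphisms `ℤ_p → k` into a ring of characteristic `p` factor through `𝔽_p` (`PadicInt.ringHom_eq_castHom_toZMod`);
  a ring homomorphism `𝒪_D → k` into a reduced ring of characteristic `p` kills `ϱ` (`map_root_eq_zero_of_pow_eq`).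
* §3 short models `⟨0, 0, 0, A₄, A₆⟩` over any ring: `Δ = −64A₄³ − 432A₆²`; **`hasseCoeff 5 = 32·A₄`** and **`hasseCoeff 7 = 192·A₆`**
  (so `A_5 = 0` iff `j̃ = 0`-shape `A₄ = 0`, `A_7 = 0` iff `j̃ = 1728`-shape `A₆ = 0`); **exact height `2` over ANY field of
  characteristic `p ≥ 5` for a supersingular curve DEFINED OVER `𝔽_p`** (`coeff_sq_formalMul_map_eq_neg_one`: `[X^{p²}][p] = −1`, by
  the tree's `coeff_sq_formalMul_ringChar_of_tr_eq_zero` over `𝔽_p` and `map_formalMul` — no hypothesis on the residue field).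
* §4 the model `W_D(a, r₄; b, r₆) = ⟨0, 0, 0, a·ϱ^{r₄}, b·ϱ^{r₆}⟩`, `a, b ∈ ℤ_p`: its discriminant is `−(64a³p^{t₄} + 432b²p^{t₆})`
  when `3r₄ = e t₄`, `2r₆ = e t₆` (`Δ_model`), a unit of `𝒪_D` when that `p`-adic integer is a unit; its reduction along any
  `γ : 𝒪_D → k`, `k` a field of characteristic `p`, is the base change of an `𝔽_p`-curve (`map_model_eq_map_castHom`), with
  `a₄ = 0` if `r₄ > 0` and `a₆ = 0` if `r₆ > 0`; hence `hasseCoeff = 0` at `p = 5` (if `r₄ > 0`) / `p = 7` (if `r₆ > 0`) and exact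
  height `2` whenever the reduction is nonsingular and supersingular.
* §5 the field side: over a field `L` with `2, 3 ≠ 0`, every `W` is `L`-isomorphic to `⟨0, 0, 0, −W.c₄/(48u⁴), −W.c₆/(864u⁶)⟩` for
  every `u ≠ 0` (`exists_variableChange_eq_short`, Mathlib's `toShortNF` followed by `(u, 0, 0, 0)`); and
  `W_D.map Coeff.toF = ⟨0, 0, 0, a·ϖ^{r₄}, b·ϖ^{r₆}⟩` (`map_model_toF`).

Used by the BSD route EdixhovenFibreFiveSeven (crux K★ `stmt-BirchSwinnertonDyer-22226`, the three potentially supersingular cells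
`(5; IV*)`, `(5; II*)`, `(7; III*)`: `e = 3, 6, 4`). BSD is not proved by any of this.

## References
* [SerreLocalFields1979] J.-P. Serre, *Local Fields* (1979), Ch. I §6 Prop. 17–18 (Eisenstein polynomials, `ℤ_p[ϖ]`).
* [SilvermanAEC2009] J. H. Silverman, *AEC* (2009), III.1 (short models, `c₄, c₆, Δ`), VII.5.5 (potential good reduction and
  `j`), IV.7.5 (height of the formal group), V.4.1 (Hasse invariant).
-/

noncomputable section

open Polynomial Field ValuativeRel

namespace Literature.NumberTheory.PAdicHodge

open Literature.NumberTheory.GaloisRepresentations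
open Literature.NumberTheory.GaloisRepresentations.IsNonarchimedeanLocalField

/-! ## §1 Pure-power Eisenstein data -/

section PurePower

variable {p : ℕ} [Fact p.Prime]

/-- **`X^e − p ∈ ℤ_p[X]` is Eisenstein at `p`** (`e ≥ 1`). [cite: SerreLocalFields1979, Ch. I §6 Prop. 17] -/
theorem isEisensteinAt_X_pow_sub_C {e : ℕ} (he : 0 < e) :
    (X ^ e - C (p : ℤ_[p])).IsEisensteinAt (Ideal.span {(p : ℤ_[p])}) := by
  have hpr : (p : ℕ).Prime := Fact.out
  have hirr : Irreducible (p : ℤ_[p]) := PadicInt.irreducible_p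
  have hmon : (X ^ e - C (p : ℤ_[p])).Monic := monic_X_pow_sub_C _ he.ne'
  have hdeg : (X ^ e - C (p : ℤ_[p])).natDegree = e := natDegree_X_pow_sub_C
  have hne : Ideal.span {(p : ℤ_[p])} ≠ ⊤ := by
    rw [Ne, Ideal.span_singleton_eq_top]; exact hirr.not_isUnit
  refine hmon.isEisensteinAt_of_mem_of_notMem hne ?_ ?_
  · intro n hn
    rw [hdeg] at hn
    rw [coeff_sub, coeff_X_pow, if_neg hn.ne, coeff_C, zero_sub, Ideal.neg_mem_iff]
    split_ifs
    · exact Ideal.mem_span_singleton_self _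
    · exact Ideal.zero_mem _
  · rw [coeff_sub, coeff_X_pow, if_neg he.ne, coeff_C_zero, zero_sub, Ideal.neg_mem_iff, Ideal.span_singleton_pow,
      Ideal.mem_span_singleton]
    intro h
    have h1 : (p : ℤ_[p]) ^ 2 ∣ (p : ℤ_[p]) ^ 1 := by rwa [pow_one]
    have := (pow_dvd_pow_iff hirr.ne_zero hirr.not_isUnit).1 h1
    omega

variable {F : Type} [Field F] [ValuativeRel F] [TopologicalSpace F] [IsNonarchimedeanLocalField F] [CharZero F]

/-- **Every `ϖ ∈ F` with `ϖ^e = p` (`e ≥ 1`) carries an Eisenstein root datum with polynomial `X^e − p`.** Existence form (no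
definition is introduced). [cite: SerreLocalFields1979, Ch. I §6 Prop. 17] -/
theorem EisensteinRoot.exists_poly_eq_X_pow_sub_C (hp : valuation F p < 1) {e : ℕ} (he : 0 < e) {ϖ : F}
    (hϖ : ϖ ^ e = p) : ∃ D : EisensteinRoot F p hp, D.poly = X ^ e - C (p : ℤ_[p]) ∧ D.root = ϖ :=
  ⟨{ poly := X ^ e - C (p : ℤ_[p])
     monic := monic_X_pow_sub_C _ he.ne'
     isEisensteinAt := isEisensteinAt_X_pow_sub_C he
     root := ϖ
     eval₂_root := by rw [eval₂_sub, eval₂_X_pow, eval₂_C, map_natCast, hϖ, sub_self] }, rfl, rfl⟩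

variable {hp : valuation F p < 1} (D : EisensteinRoot F p hp) {e : ℕ}

/-- For `D.poly = X^e − p` (`e ≥ 1`): `D.e = e`. [cite: SerreLocalFields1979, Ch. I §6 Prop. 18] -/
theorem EisensteinRoot.e_eq_of_poly_eq (hD : D.poly = X ^ e - C (p : ℤ_[p])) : D.e = e := by
  rw [EisensteinRoot.e_def, hD, natDegree_X_pow_sub_C]

/-- For `D.poly = X^e − p`: **`ϱ^e = p` in `𝒪_D`**, `ϱ` the class of `X`. [cite: SerreLocalFields1979, Ch. I §6 Prop. 18] -/
theorem EisensteinRoot.root_pow_eq_of_poly_eq (hD : D.poly = X ^ e - C (p : ℤ_[p])) :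
    AdjoinRoot.root D.poly ^ e = AdjoinRoot.of D.poly p := by
  have h := congrArg (fun q : ℤ_[p][X] => q.eval₂ (AdjoinRoot.of D.poly) (AdjoinRoot.root D.poly)) hD
  simp only [AdjoinRoot.eval₂_root, eval₂_sub, eval₂_X_pow, eval₂_C] at h
  exact (sub_eq_zero.1 h.symm)

/-- For `D.poly = X^e − p`: **`ϖ^e = p` in `F`**. [cite: SerreLocalFields1979, Ch. I §6 Prop. 17] -/
theorem EisensteinRoot.rootF_pow_eq_of_poly_eq (hD : D.poly = X ^ e - C (p : ℤ_[p])) : D.root ^ e = p := by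
  have h := congrArg (fun q : ℤ_[p][X] => q.eval₂ (zpToF hp) D.root) hD
  simp only [D.eval₂_root, eval₂_sub, eval₂_X_pow, eval₂_natCast, map_natCast] at h
  exact (sub_eq_zero.1 h.symm)

/-- For `D.poly = X^e − p`: `ϖ ≠ 0`. [cite: SerreLocalFields1979, Ch. I §6 Prop. 17] -/
theorem EisensteinRoot.root_ne_zero_of_poly_eq (hD : D.poly = X ^ e - C (p : ℤ_[p])) : D.root ≠ 0 := by
  intro h0
  have he : 0 < e := by have := D.e_pos; rwa [D.e_eq_of_poly_eq hD] at this
  have h := D.rootF_pow_eq_of_poly_eq hD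
  rw [h0, zero_pow he.ne'] at h
  exact (Nat.cast_ne_zero.2 (Fact.out : p.Prime).ne_zero) h.symm

end PurePower

/-! ## §2 Ring homomorphisms out of `ℤ_p` and `𝒪_D` into characteristic `p` -/

section CharP

variable {p : ℕ} [Fact p.Prime]

/-- **A ring homomorphism `ℤ_p → k` into a ring of characteristic `p` is reduction mod `p` followed by `𝔽_p → k`** (`ℤ_p/pℤ_p = 𝔽_p`).
[cite: SerreLocalFields1979, Ch. II §5] -/
theorem PadicInt.ringHom_eq_castHom_toZMod {k : Type*} [CommRing k] [CharP k p] (ψ : ℤ_[p] →+* k) (x : ℤ_[p]) :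
    ψ x = ZMod.castHom (dvd_refl p) k (PadicInt.toZMod x) := by
  have hx : x - (PadicInt.zmodRepr x : ℤ_[p]) ∈ IsLocalRing.maximalIdeal ℤ_[p] := PadicInt.sub_zmodRepr_mem x
  rw [PadicInt.maximalIdeal_eq_span_p, Ideal.mem_span_singleton] at hx
  obtain ⟨c, hc⟩ := hx
  have h1 : x = (PadicInt.zmodRepr x : ℤ_[p]) + (p : ℤ_[p]) * c := by rw [← hc]; ring
  have h2 : PadicInt.toZMod x = (PadicInt.zmodRepr x : ZMod p) := rfl
  calc ψ x = ψ ((PadicInt.zmodRepr x : ℤ_[p]) + (p : ℤ_[p]) * c) := by rw [← h1]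
    _ = (PadicInt.zmodRepr x : k) := by
      rw [map_add, map_natCast, map_mul, map_natCast, CharP.cast_eq_zero k p, zero_mul, add_zero]
    _ = ZMod.castHom (dvd_refl p) k (PadicInt.toZMod x) := by rw [h2, map_natCast]

/-- The composite `ℤ_p → 𝒪_D → k` (`k` of characteristic `p`) is `𝔽_p → k` after reduction. [cite: SerreLocalFields1979, Ch. II §5] -/
theorem ringHom_of_eq_castHom_toZMod {f : ℤ_[p][X]} {k : Type*} [CommRing k] [CharP k p] (γ : AdjoinRoot f →+* k)
    (x : ℤ_[p]) : γ (AdjoinRoot.of f x) = ZMod.castHom (dvd_refl p) k (PadicInt.toZMod x) :=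
  PadicInt.ringHom_eq_castHom_toZMod (γ.comp (AdjoinRoot.of f)) x

/-- **A ring homomorphism `𝒪_D → k` into a REDUCED ring of characteristic `p` kills `ϱ`** when `ϱ^e = p`
(`γ(ϱ)^e = p = 0`; the residue field of `ℤ_p[ϖ]` is `𝔽_p`). [cite: SerreLocalFields1979, Ch. I §6 Prop. 18] -/
theorem map_root_eq_zero_of_pow_eq {f : ℤ_[p][X]} {e : ℕ}
    (hroot : AdjoinRoot.root f ^ e = AdjoinRoot.of f p) {k : Type*} [CommRing k] [CharP k p] [IsReduced k]
    (γ : AdjoinRoot f →+* k) : γ (AdjoinRoot.root f) = 0 := by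
  apply IsReduced.eq_zero _ ⟨e, ?_⟩
  rw [← map_pow, hroot, ringHom_of_eq_castHom_toZMod, map_natCast, map_natCast, CharP.cast_eq_zero k p]

end CharP

/-! ## §3 Short models over any ring: `Δ`, Hasse coefficient at `5` and `7`, exact height by `𝔽_p`-descent -/

section Short

variable {R : Type*} [CommRing R]

/-- `Δ(⟨0,0,0,A₄,A₆⟩) = −64A₄³ − 432A₆²`. [cite: SilvermanAEC2009, III.1 (p. 42)] -/
theorem Δ_short (A₄ A₆ : R) : (⟨0, 0, 0, A₄, A₆⟩ : WeierstrassCurve R).Δ = -(64 * A₄ ^ 3 + 432 * A₆ ^ 2) := by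
  simp only [WeierstrassCurve.Δ, WeierstrassCurve.b₂, WeierstrassCurve.b₄, WeierstrassCurve.b₆, WeierstrassCurve.b₈]
  ring

/-- The `2`-torsion cubic of `⟨0,0,0,A₄,A₆⟩` is `4X³ + 4A₄X + 4A₆`. [cite: SilvermanAEC2009, III.1] -/
theorem twoTorsionPolynomial_toPoly_short (A₄ A₆ : R) :
    (⟨0, 0, 0, A₄, A₆⟩ : WeierstrassCurve R).twoTorsionPolynomial.toPoly = 4 * X ^ 3 + C (4 * A₄) * X + C (4 * A₆) := by
  simp only [WeierstrassCurve.twoTorsionPolynomial, WeierstrassCurve.b₂, WeierstrassCurve.b₄, WeierstrassCurve.b₆, Cubic.toPoly]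
  simp only [map_ofNat, mul_zero, zero_pow two_ne_zero, add_zero, zero_add, map_zero, zero_mul]
  rw [show (2 * (2 * A₄) : R) = 4 * A₄ by ring]

/-- **`hasseCoeff 5 (⟨0,0,0,A₄,A₆⟩) = 32·A₄`** (coefficient of `X⁴` in `(4X³ + 4A₄X + 4A₆)²`). [cite: SilvermanAEC2009, V.4.1] -/
theorem hasseCoeff_five_short (A₄ A₆ : R) : (⟨0, 0, 0, A₄, A₆⟩ : WeierstrassCurve R).hasseCoeff 5 = 32 * A₄ := by
  rw [WeierstrassCurve.hasseCoeff, twoTorsionPolynomial_toPoly_short, show (5 - 1) / 2 = 2 from rfl,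
    show (5 : ℕ) - 1 = 4 from rfl]
  have h : (4 * X ^ 3 + C (4 * A₄) * X + C (4 * A₆) : R[X]) ^ 2 =
      C 16 * X ^ 6 + C (32 * A₄) * X ^ 4 + C (32 * A₆) * X ^ 3 + C (16 * A₄ ^ 2) * X ^ 2 + C (32 * A₄ * A₆) * X +
        C (16 * A₆ ^ 2) := by
    simp only [map_mul, map_pow, map_ofNat]
    ring
  rw [h]
  simp only [coeff_add, coeff_C_mul_X_pow, coeff_C_mul_X, coeff_C]
  norm_num

/-- **`hasseCoeff 7 (⟨0,0,0,A₄,A₆⟩) = 192·A₆`** (coefficient of `X⁶` in `(4X³ + 4A₄X + 4A₆)³`). [cite: SilvermanAEC2009, V.4.1] -/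
theorem hasseCoeff_seven_short (A₄ A₆ : R) : (⟨0, 0, 0, A₄, A₆⟩ : WeierstrassCurve R).hasseCoeff 7 = 192 * A₆ := by
  rw [WeierstrassCurve.hasseCoeff, twoTorsionPolynomial_toPoly_short, show (7 - 1) / 2 = 3 from rfl,
    show (7 : ℕ) - 1 = 6 from rfl]
  have h : (4 * X ^ 3 + C (4 * A₄) * X + C (4 * A₆) : R[X]) ^ 3 =
      C 64 * X ^ 9 + C (192 * A₄) * X ^ 7 + C (192 * A₆) * X ^ 6 + C (192 * A₄ ^ 2) * X ^ 5 + C (384 * A₄ * A₆) * X ^ 4 +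
        C (64 * A₄ ^ 3 + 192 * A₆ ^ 2) * X ^ 3 + C (192 * A₄ ^ 2 * A₆) * X ^ 2 + C (192 * A₄ * A₆ ^ 2) * X +
          C (64 * A₆ ^ 3) := by
    simp only [map_mul, map_pow, map_add, map_ofNat]
    ring
  rw [h]
  simp only [coeff_add, coeff_C_mul_X_pow, coeff_C_mul_X, coeff_C]
  norm_num

variable {p : ℕ} [Fact p.Prime]

/-- **Exact height `2` over ANY field of characteristic `p ≥ 5` for a supersingular curve DEFINED OVER `𝔽_p`**: if `E = E₀ ⊗ k` with
`E₀/𝔽_p`, `Δ(E) ≠ 0` and `A_p(E) = 0`, then `[X^{p²}] [p]_E = −1` (Hasse's bound forces `a_p(E₀) = 0`, then `[p] = ĩ(X^{p²})` over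
`𝔽_p`, transported along `𝔽_p → k`). [cite: SilvermanAEC2009, IV.7.5 and Ex. V.5.10] -/
theorem coeff_sq_formalMul_map_eq_neg_one (hp5 : 5 ≤ p) {k : Type*} [Field k] (φ : ZMod p →+* k)
    (E₀ : WeierstrassCurve (ZMod p)) (hΔ : (E₀.map φ).Δ ≠ 0) (hA : (E₀.map φ).hasseCoeff p = 0) :
    PowerSeries.coeff (p ^ 2) ((E₀.map φ).formalMul p) = -1 := by
  have hp2 : p ≠ 2 := by omega
  have hΔ₀ : E₀.Δ ≠ 0 := by
    intro h; apply hΔ; rw [WeierstrassCurve.map_Δ, h, map_zero]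
  haveI : E₀.IsElliptic := ⟨isUnit_iff_ne_zero.2 hΔ₀⟩
  have hA₀ : E₀.hasseCoeff p = 0 := by
    rw [WeierstrassCurve.map_hasseCoeff] at hA
    exact φ.injective (by rw [hA, map_zero])
  have htr := Literature.NumberTheory.EllipticCurves.HasseManin.tr_eq_zero_of_dvd_of_five_le E₀ (ZMod.card p) hp5
    ((E₀.hasseCoeff_eq_zero_iff_dvd_tr hp2).1 hA₀)
  rw [← WeierstrassCurve.map_formalMul, PowerSeries.coeff_map, E₀.coeff_sq_formalMul_ringChar_of_tr_eq_zero htr, map_neg,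
    map_one]

/-- **Exact height `2`, non-vanishing form**: `[X^{p²}] [p]_E ≠ 0` for `E = E₀ ⊗ k` nonsingular supersingular, `p ≥ 5`.
[cite: SilvermanAEC2009, IV.7.5] -/
theorem coeff_sq_formalMul_map_ne_zero (hp5 : 5 ≤ p) {k : Type*} [Field k] (φ : ZMod p →+* k)
    (E₀ : WeierstrassCurve (ZMod p)) (hΔ : (E₀.map φ).Δ ≠ 0) (hA : (E₀.map φ).hasseCoeff p = 0) :
    PowerSeries.coeff (p ^ 2) ((E₀.map φ).formalMul p) ≠ 0 := by
  rw [coeff_sq_formalMul_map_eq_neg_one hp5 φ E₀ hΔ hA, neg_ne_zero]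
  exact one_ne_zero

end Short

/-! ## §4 The models `⟨0, 0, 0, a·ϱ^{r₄}, b·ϱ^{r₆}⟩` over `𝒪_D` -/

section Model

variable {p : ℕ} [Fact p.Prime] {f : ℤ_[p][X]} {e : ℕ}

/-- **Discriminant of the model**: for `ϱ^e = p`, `3r₄ = e·t₄`, `2r₆ = e·t₆`,
`Δ(⟨0,0,0,a ϱ^{r₄}, b ϱ^{r₆}⟩) = −(64 a³ p^{t₄} + 432 b² p^{t₆})` (an element of `ℤ_p`). [cite: SilvermanAEC2009, III.1 and VII.5.5] -/
theorem Δ_model (hroot : AdjoinRoot.root f ^ e = AdjoinRoot.of f p) (a b : ℤ_[p]) {r₄ r₆ t₄ t₆ : ℕ}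
    (h₄ : 3 * r₄ = e * t₄) (h₆ : 2 * r₆ = e * t₆) :
    (⟨0, 0, 0, AdjoinRoot.of f a * AdjoinRoot.root f ^ r₄, AdjoinRoot.of f b * AdjoinRoot.root f ^ r₆⟩ :
        WeierstrassCurve (AdjoinRoot f)).Δ =
      AdjoinRoot.of f (-(64 * a ^ 3 * p ^ t₄ + 432 * b ^ 2 * p ^ t₆)) := by
  rw [Δ_short]
  have e4 : (AdjoinRoot.root f ^ r₄) ^ 3 = AdjoinRoot.of f ((p : ℤ_[p]) ^ t₄) := by
    rw [← pow_mul, mul_comm, h₄, pow_mul, hroot, map_pow]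
  have e6 : (AdjoinRoot.root f ^ r₆) ^ 2 = AdjoinRoot.of f ((p : ℤ_[p]) ^ t₆) := by
    rw [← pow_mul, mul_comm, h₆, pow_mul, hroot, map_pow]
  rw [mul_pow, mul_pow, e4, e6]
  simp only [map_neg, map_add, map_mul, map_pow, map_ofNat, map_natCast]
  ring

/-- **Unit discriminant**: if `64 a³ p^{t₄} + 432 b² p^{t₆} ∈ ℤ_pˣ` then `Δ` of the model is a unit of `𝒪_D`.
[cite: SilvermanAEC2009, VII.5.5] -/
theorem isUnit_Δ_model (hroot : AdjoinRoot.root f ^ e = AdjoinRoot.of f p) (a b : ℤ_[p]) {r₄ r₆ t₄ t₆ : ℕ}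
    (h₄ : 3 * r₄ = e * t₄) (h₆ : 2 * r₆ = e * t₆) (hu : IsUnit (64 * a ^ 3 * p ^ t₄ + 432 * b ^ 2 * p ^ t₆ : ℤ_[p])) :
    IsUnit (⟨0, 0, 0, AdjoinRoot.of f a * AdjoinRoot.root f ^ r₄, AdjoinRoot.of f b * AdjoinRoot.root f ^ r₆⟩ :
        WeierstrassCurve (AdjoinRoot f)).Δ := by
  rw [Δ_model hroot a b h₄ h₆, map_neg, IsUnit.neg_iff]
  exact hu.map _

/-- **Reduction of the model is defined over `𝔽_p`**: along any `γ : 𝒪_D → k` into a field of characteristic `p` (so `γ(ϱ) = 0`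
when `ϱ^e = p`), `W_D ⊗_γ k = E₀ ⊗ k` with `E₀ = ⟨0,0,0, [r₄ = 0]·ā, [r₆ = 0]·b̄⟩` over `𝔽_p`. [cite: SilvermanAEC2009, VII.5.5] -/
theorem map_model_eq_map_castHom (hroot : AdjoinRoot.root f ^ e = AdjoinRoot.of f p) (a b : ℤ_[p])
    (r₄ r₆ : ℕ) {k : Type*} [Field k] [CharP k p] (γ : AdjoinRoot f →+* k) :
    (⟨0, 0, 0, AdjoinRoot.of f a * AdjoinRoot.root f ^ r₄, AdjoinRoot.of f b * AdjoinRoot.root f ^ r₆⟩ :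
        WeierstrassCurve (AdjoinRoot f)).map γ =
      (⟨0, 0, 0, if r₄ = 0 then PadicInt.toZMod a else 0, if r₆ = 0 then PadicInt.toZMod b else 0⟩ :
        WeierstrassCurve (ZMod p)).map (ZMod.castHom (dvd_refl p) k) := by
  have hγ : γ (AdjoinRoot.root f) = 0 := map_root_eq_zero_of_pow_eq hroot γ
  ext
  · simp [WeierstrassCurve.map]
  · simp [WeierstrassCurve.map]
  · simp [WeierstrassCurve.map]
  · simp only [WeierstrassCurve.map, map_mul, map_pow, hγ, ringHom_of_eq_castHom_toZMod]
    split_ifs with h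
    · rw [h, pow_zero, mul_one]
    · rw [zero_pow h, mul_zero, map_zero]
  · simp only [WeierstrassCurve.map, map_mul, map_pow, hγ, ringHom_of_eq_castHom_toZMod]
    split_ifs with h
    · rw [h, pow_zero, mul_one]
    · rw [zero_pow h, mul_zero, map_zero]

/-- **`A_5 = 0` for the model when `r₄ > 0`** (reduction `y² = x³ + b̄`, `j̃ = 0`, supersingular at `5 ≡ 2 (3)`), read along
any `γ : 𝒪_D → k` into a field of characteristic `5`. [cite: SilvermanAEC2009, V.4.1 and Ex. V.4.4] -/
theorem hasseCoeff_map_model_five_eq_zero [Fact (5 : ℕ).Prime] {f : ℤ_[5][X]}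
    (hroot : AdjoinRoot.root f ^ e = AdjoinRoot.of f (5 : ℕ)) (a b : ℤ_[5]) {r₄ : ℕ} (hr₄ : 0 < r₄) (r₆ : ℕ)
    {k : Type*} [Field k] [CharP k 5] (γ : AdjoinRoot f →+* k) :
    ((⟨0, 0, 0, AdjoinRoot.of f a * AdjoinRoot.root f ^ r₄, AdjoinRoot.of f b * AdjoinRoot.root f ^ r₆⟩ :
        WeierstrassCurve (AdjoinRoot f)).map γ).hasseCoeff 5 = 0 := by
  rw [map_model_eq_map_castHom hroot a b r₄ r₆ γ, if_neg hr₄.ne', WeierstrassCurve.map_hasseCoeff, hasseCoeff_five_short,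
    mul_zero, map_zero]

/-- **`A_7 = 0` for the model when `r₆ > 0`** (reduction `y² = x³ + ā x`, `j̃ = 1728`, supersingular at `7 ≡ 3 (4)`), read along
any `γ : 𝒪_D → k` into a field of characteristic `7`. [cite: SilvermanAEC2009, V.4.1 and Ex. V.4.5] -/
theorem hasseCoeff_map_model_seven_eq_zero [Fact (7 : ℕ).Prime] {f : ℤ_[7][X]}
    (hroot : AdjoinRoot.root f ^ e = AdjoinRoot.of f (7 : ℕ)) (a b : ℤ_[7]) (r₄ : ℕ) {r₆ : ℕ} (hr₆ : 0 < r₆)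
    {k : Type*} [Field k] [CharP k 7] (γ : AdjoinRoot f →+* k) :
    ((⟨0, 0, 0, AdjoinRoot.of f a * AdjoinRoot.root f ^ r₄, AdjoinRoot.of f b * AdjoinRoot.root f ^ r₆⟩ :
        WeierstrassCurve (AdjoinRoot f)).map γ).hasseCoeff 7 = 0 := by
  rw [map_model_eq_map_castHom hroot a b r₄ r₆ γ, if_neg hr₆.ne', WeierstrassCurve.map_hasseCoeff, hasseCoeff_seven_short,
    mul_zero, map_zero]

/-- **Exact height `2` of the reduction of the model** along any `γ : 𝒪_D → k` into a field of characteristic `p ≥ 5`, as soon as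
that reduction is nonsingular and supersingular. [cite: SilvermanAEC2009, IV.7.5] -/
theorem coeff_sq_formalMul_map_model_ne_zero (hp5 : 5 ≤ p) (hroot : AdjoinRoot.root f ^ e = AdjoinRoot.of f p)
    (a b : ℤ_[p]) (r₄ r₆ : ℕ) {k : Type*} [Field k] [CharP k p] (γ : AdjoinRoot f →+* k)
    (hΔ : ((⟨0, 0, 0, AdjoinRoot.of f a * AdjoinRoot.root f ^ r₄, AdjoinRoot.of f b * AdjoinRoot.root f ^ r₆⟩ :
        WeierstrassCurve (AdjoinRoot f)).map γ).Δ ≠ 0)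
    (hA : ((⟨0, 0, 0, AdjoinRoot.of f a * AdjoinRoot.root f ^ r₄, AdjoinRoot.of f b * AdjoinRoot.root f ^ r₆⟩ :
        WeierstrassCurve (AdjoinRoot f)).map γ).hasseCoeff p = 0) :
    PowerSeries.coeff (p ^ 2) (((⟨0, 0, 0, AdjoinRoot.of f a * AdjoinRoot.root f ^ r₄,
        AdjoinRoot.of f b * AdjoinRoot.root f ^ r₆⟩ : WeierstrassCurve (AdjoinRoot f)).map γ).formalMul p) ≠ 0 := by
  rw [map_model_eq_map_castHom hroot a b r₄ r₆ γ] at hΔ hA ⊢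
  exact coeff_sq_formalMul_map_ne_zero hp5 _ _ hΔ hA

/-- **Unit discriminant survives reduction**: `Δ(W_D ⊗_γ k) ≠ 0` for a unit `Δ(W_D)`. [cite: SilvermanAEC2009, VII.5.1] -/
theorem Δ_map_ne_zero_of_isUnit {S : Type*} [CommRing S] (W : WeierstrassCurve S) (hΔ : IsUnit W.Δ) {k : Type*} [Field k]
    (γ : S →+* k) : (W.map γ).Δ ≠ 0 := by
  rw [WeierstrassCurve.map_Δ]; exact (hΔ.map γ).ne_zero

end Model

/-! ## §5 The field side -/

section FieldSide

/-- **Every Weierstrass equation over a field with `2, 3 ≠ 0` is isomorphic to `y² = x³ − c₄/(48u⁴)·x − c₆/(864u⁶)`** for every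
`u ≠ 0` (Mathlib's `toShortNF`, then the rescaling `(u, 0, 0, 0)`; `c₄, c₆` scale by `u⁻⁴, u⁻⁶`). Existence form.
[cite: SilvermanAEC2009, III.1 (p. 42–45)] -/
theorem exists_variableChange_eq_short {L : Type*} [Field L] (h2 : (2 : L) ≠ 0) (h3 : (3 : L) ≠ 0) (W : WeierstrassCurve L)
    {u : L} (hu : u ≠ 0) :
    ∃ C : WeierstrassCurve.VariableChange L,
      C • W = ⟨0, 0, 0, -W.c₄ / (48 * u ^ 4), -W.c₆ / (864 * u ^ 6)⟩ := by
  letI : Invertible (2 : L) := invertibleOfNonzero h2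
  letI : Invertible (3 : L) := invertibleOfNonzero h3
  set S := W.toShortNF • W with hS
  haveI : S.IsShortNF := W.toShortNF_spec
  have hc4 : S.c₄ = W.c₄ := by rw [hS, WeierstrassCurve.variableChange_c₄]; simp [WeierstrassCurve.toShortNF,
    WeierstrassCurve.toCharNeTwoNF, WeierstrassCurve.VariableChange.mul_def]
  have hc6 : S.c₆ = W.c₆ := by rw [hS, WeierstrassCurve.variableChange_c₆]; simp [WeierstrassCurve.toShortNF,
    WeierstrassCurve.toCharNeTwoNF, WeierstrassCurve.VariableChange.mul_def]
  have h48 : (48 : L) ≠ 0 := by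
    have : (48 : L) = 2 ^ 4 * 3 := by norm_num
    rw [this]; exact mul_ne_zero (pow_ne_zero _ h2) h3
  have h864 : (864 : L) ≠ 0 := by
    have : (864 : L) = 2 ^ 5 * 3 ^ 3 := by norm_num
    rw [this]; exact mul_ne_zero (pow_ne_zero _ h2) (pow_ne_zero _ h3)
  have ha4 : S.a₄ = -W.c₄ / 48 := by
    rw [← hc4, S.c₄_of_isShortNF]; field_simp
  have ha6 : S.a₆ = -W.c₆ / 864 := by
    rw [← hc6, S.c₆_of_isShortNF]; field_simp
  refine ⟨⟨Units.mk0 u hu, 0, 0, 0⟩ * W.toShortNF, ?_⟩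
  rw [mul_smul, ← hS]
  ext
  · simp [WeierstrassCurve.variableChange_a₁]
  · simp [WeierstrassCurve.variableChange_a₂]
  · simp [WeierstrassCurve.variableChange_a₃]
  · simp only [WeierstrassCurve.variableChange_a₄, S.a₁_of_isShortNF, S.a₂_of_isShortNF, S.a₃_of_isShortNF, ha4]
    simp
    field_simp
  · simp only [WeierstrassCurve.variableChange_a₆, S.a₁_of_isShortNF, S.a₂_of_isShortNF, S.a₃_of_isShortNF, ha6]
    simp
    field_simp

variable {F : Type} [Field F] [ValuativeRel F] [TopologicalSpace F] [IsNonarchimedeanLocalField F] [CharZero F]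
  {p : ℕ} [Fact p.Prime] {hp : valuation F p < 1} (D : EisensteinRoot F p hp)

/-- **The model over `F`**: `W_D(a, r₄; b, r₆) ⊗ F = ⟨0, 0, 0, a·ϖ^{r₄}, b·ϖ^{r₆}⟩` along `Coeff.toF : 𝒪_D → F`.
[cite: SerreLocalFields1979, Ch. I §6 Prop. 18] -/
theorem map_model_toF (a b : ℤ_[p]) (r₄ r₆ : ℕ) :
    (⟨0, 0, 0, AdjoinRoot.of D.poly a * AdjoinRoot.root D.poly ^ r₄, AdjoinRoot.of D.poly b * AdjoinRoot.root D.poly ^ r₆⟩ :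
        WeierstrassCurve D.Coeff).map (EisensteinRoot.Coeff.toF D) =
      ⟨0, 0, 0, zpToF hp a * D.root ^ r₄, zpToF hp b * D.root ^ r₆⟩ := by
  ext <;> simp [WeierstrassCurve.map]

end FieldSide

end Literature.NumberTheory.PAdicHodge

end
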